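import Mathlib.LinearAlgebra.Matrix.Rank
import Mathlib.LinearAlgebra.Matrix.Determinant.Basic
import Mathlib.Data.Nat.Choose.Bounds
import Mathlib.Data.Nat.Factorial.Basic
import Mathlib.Data.Finset.Powerset
import Mathlib.Algebra.BigOperators.Ring.Finset
import Mathlib.Algebra.Order.Floor.Semiring
import Mathlib.Analysis.Complex.Exponential
import Mathlib.Analysis.Complex.ExponentialBounds
import Mathlib.Analysis.SpecialFunctions.Pow.Real
import Mathlib.Analysis.SpecialFunctions.Log.Basic
import Mathlib.Order.Filter.AtTopBot.Basic
import HarnessLib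

/-!
# Barrier catalogue `PneNP`: the barrier of purely combinatorial approaches to matrix rigidity
(Valiant 1977; Shokrollahi–Spielman–Stemann 1997; Lokam 2000/2009)

D-0021 barrier entry for the summit `PneNP`: it caps Valiant's rigidity road towards superlinear
size lower bounds for logarithmic-depth (linear) circuits computing an explicit linear map (cf.
route PneNP/Circuit crux #2, superlinear size for an NP language; the rigidity road itself is
not filed as a crux on that route, which files only Boolean cruxes). The lower-bound proofs for
the rigidity of explicit matrices all run "(1) all square submatrices have full rank; (2) too
few changes leave a large submatrix untouched", and BOTH steps are provably capped far below the
`R_A(εn) ≥ n^{1+δ}` that Valiant's criterion needs.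

**The printed results** (S. V. Lokam, *Complexity lower bounds using linear algebra*,
Found. Trends TCS 4 (2009) 1–155; held, `lit read paper:doi-10-1561-0400000011`, PDF pages):

* Def. 2.1 (PDF p. 14): "The rigidity of a matrix `A` over a field `F`, denoted `R^F_A(r)`, is
  the least number of entries of `A` that must be changed in order to reduce the rank of `A` to
  a value at most `r`: `R^F_A(r) := min{|C| : rank_F(A + C) ≤ r}`, where `|C|` denotes the
  number of nonzero entries of `C`." Open Question 2.1 (PDF p. 15, Valiant): explicit `{A_n}`
  with `R_{A_n}(εn) ≥ n^{1+δ}`.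
* Thm. 2.1 (PDF p. 17, Valiant 1977): if `x ↦ Ax` is computed by a linear circuit of size `s`
  and depth `d` (fan-in two), then `R_A(s log t / log d) ≤ 2^{O(d/t)} · n` for every `t > 1`;
  "In particular, if `R_A(εn) ≥ n^{1+δ}` for some constants `ε, δ > 0`, then any linear circuit
  of logarithmic depth computing `x ↦ Ax` must have size `Ω(n log log n)`."
* Lemma 2.4 (PDF p. 19) and Thms. 2.5–2.11: the best known explicit bounds
  `R_A(r) = Ω((n²/r) log(n/r))` (Cauchy, codes, Fourier of prime order — all square submatrices
  nonsingular) and `Ω(n²/r)` (Hadamard), "we assume `r ≤ n/2`" (PDF p. 20).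
* **§2.2.1 Limitations of the Combinatorial Proof Techniques (PDF p. 24):** "proofs of the best
  known lower bounds on rigidity of explicit matrices follow essentially the same strategy and
  consist of two steps: (1) all (or most) square submatrices of these matrices have full- (or
  close to full) rank; (2) if the number of changes is too small, then one such submatrix
  remains untouched. ... Any proof relying on the second step in the above strategy, i.e, using
  an untouched submatrix of rank `Ω(r)`, is incapable of producing a lower bound better than
  `Ω((n²/r) log(n/r))`. Indeed, using Lovász's result relating fractional and integral vertex
  covers of a hypergraph, we can show that the bound in Lemma 2.4 is asymptotically tight.
  Specifically, consider the hypergraph whose vertices are the entries of an `n × n` matrix and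
  hyperedges are all `(r+1) × (r+1)` submatrices. ... Hence,
  `(n²/(r+1)²)(1 + ln C(n-1, r)²) = O((n²/r) log(n/(r+1)))` changes suffice." — i.e. that many
  entries meet EVERY `(r+1) × (r+1)` submatrix. "The best bound provable by the first step of
  the above approach is limited by linear size superconcentrators (of logarithmic depth)":
  **Thm. 2.12 (PDF p. 25, Valiant):** "There exist `n × n` matrices `A` with integer entries
  such that all submatrices of `A` of all sizes are nonsingular, and yet `R_A(r) = n^{1+o(1)}`
  for `r = εn` for any `ε > 0`." (Proof, PDF pp. 25–26: from a linear-size, logarithmic-depth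
  superconcentrator one builds an integer linear circuit computing a totally nonsingular `A`;
  Thm. 2.1's decomposition gives `A = B + C`, `rank(B) ≤ εn`, `|C| ≤ n · 2^{log^{1-δ} n}`.)
* §2.4 (PDF p. 27): "some commonly used approaches to the rigidity problem face certain
  fundamental limitations: we call this the barrier of purely combinatorial approaches since the
  proof techniques essentially use only the connectivity (superconcentrator-like) properties and
  combinatorial structure of submatrices of the candidate matrices appealing very little to their
  algebraic structure"; Thms. 2.18–2.21, Cor. 2.19 (PDF pp. 33–35): quadratic bounds
  `R_P(r) ≥ n(n - 16r)` via algebraic dimension for matrices of square roots of distinct primes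
  or of algebraically independent entries.
* [AlmanWilliams2017] Thm. 1.1 (arXiv p. 4, held): "For every field `K`, for every sufficiently
  small `ε > 0`, and for all `n`, we have `R_{H_n}(2^{n - f(ε)n}) ≤ 2^{n(1+ε)}` over `K`, for a
  function `f` where `f(ε) = Θ(ε²/log(1/ε))`" — "the matrix rigidity approach to arithmetic
  circuit lower bounds does not apply to Hadamard matrices such as the Walsh–Hadamard
  transform"; [DvirLiu2019] abstract (held): circulant, Toeplitz and DFT matrices "are not
  sufficiently rigid to carry out Valiant's approach".

**What this file adds.** Rigidity `rigidity A r` (Def. 2.1, over any field, via Mathlib's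
`Matrix.rank`) and total nonsingularity `IsTotallyNonsingular` as definitions with the easy API
(`rigidity_of_rank_le`, `rigidity_le_card`). Limitation (i) — the untouched-submatrix cover —
is the named clause `UntouchedSubmatrixCap`, PROVED here (`untouched_submatrix_cover`): for
all `1 ≤ r ≤ n/2` some set of at most `6 (n²/r) ln(n/r)` positions meets every
`(r+1) × (r+1)` submatrix (`untouched_submatrix_cover_bigO`: the printed `O(·)` form). (Lokam derives the
`O((n²/r) log(n/r))` cover from Lovász's fractional-cover bound; the proof below is the
union-bound count `C(n,r+1)² · C(n²-(r+1)², m) < C(n², m)` for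
`m = ⌊2n² ln C(n,r+1)/(r+1)²⌋ + 1`, via `C(N-k,m) N^m ≤ C(N,m) (N-k)^m`, `1 - x ≤ e^{-x}` and
`C(n,k) ≤ (en/k)^k` — same statement, explicit constant.) Limitation (ii), Thm. 2.12 (Valiant's
ONE family of totally nonsingular integer matrices of rigidity `n^{1+o(1)}` at rank `εn` for
every `ε`, from one linear-size superconcentrator), is the named fact `Lokam2009_thm_2_12` in its
printed one-family form (the superconcentrator construction and Thm. 2.1's decomposition are
not re-proved; only the upper bound half of "`R_A(r) = n^{1+o(1)}`" is vendored), with the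
pointwise `∀ ε η, ∀ᶠ n, ∃ A` form derived (`Lokam2009_thm_2_12.forall_eventually_exists`); the
barrier `RigidityCombinatorialBarrier` is the conjunction (i) ∧ (ii), equivalent to (ii) given
the proof of (i) (`rigidityCombinatorialBarrier_iff`). Both (ii) and the barrier are PROVED in
the sibling file `Literature/Barriers/PneNP/RigidityCombinatorialBarrierProofs.lean`
(`Lokam2009_thm_2_12_holds`, `RigidityCombinatorialBarrier_holds`) — not by the printed
superconcentrator route but from the sharp cap below at the vanishing rank `⌊n/⌊log₂ n⌋⌋` and
antitonicity of rigidity in the target rank. Proved readings: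
`no_untouched_submatrix_bound` (unconditional): an argument whose only output is "after fewer
than `R` changes some `(r+1) × (r+1)` submatrix is untouched" certifies `R ≤ 6 (n²/r) ln(n/r)`;
`exists_totallyNonsingular_not_rigid` (from (ii)): one totally nonsingular family failing
`R_A(εn) ≥ n^{1+δ}` for every `ε, δ > 0`.

**Added by the barrier audit (2026-08-14).** Clause (ii) as printed is far from sharp.
The named clause `TotalNonsingularityCap` (end of this file) records the sharp form — for all
`1 ≤ r ≤ n/2` some totally nonsingular integer matrix has `R^ℚ_A(r) ≤ 6 (n²/r) ln(n/r)`, the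
very quantity of clause (i), hence `O(n)` at rank `εn` — and it is PROVED in the sibling file
`Literature/Barriers/PneNP/RigidityCombinatorialBarrierProofs.lean` (`totalNonsingularity_cap`;
mechanism: a hitting set `T` for the `(r+1) × (r+1)` submatrices becomes the sparse part of
`A = U Vᵀ + C_T` at a generic integer point; conversely the support of an optimal change of a
totally nonsingular matrix is a hitting set, so the least rigidity over totally nonsingular
matrices EQUALS the least hitting set, `exists_hitting_iff_exists_totallyNonsingular`). So the
two printed limitations are one: whatever an argument certifies from total nonsingularity (any
submatrix-rank profile, touched or untouched submatrices, one or many), it certifies for the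
witness `A_T`, i.e. at most the step-(2) quantity. The audit's literature search added to
`evasions_known:` two lines of work OUTSIDE this technique class that do exceed the step-(2)
quantity in their own regimes — PCP-based `FNP` constructions [BhangaleEtAl2020] (and
Alman–Chen 2019, quoted there) at rank `N^{o(1)}`, and Goldreich–Tal's semi-explicit random
Toeplitz matrices (quoted there) for `√N ≤ ρ ≤ N/log² N` — neither `P`-explicit at rank `εn`.

## Sources

* [Lokam2009] PDF pp. 6–7, 13–27, 33–36 (§1.1, §2.1 Def. 2.1–2.2, Thm. 2.1, Open Question 2.1,
  §2.2 Lemma 2.3–2.4, Thms. 2.5–2.12, §2.2.1, §2.3, §2.4) — held.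
* [AlmanWilliams2017] arXiv:1611.05558 pp. 2, 4 (abstract, Thm. 1.1) — held.
* [DvirLiu2019] arXiv:1902.07334 p. 2 (abstract) — held.
* [BhangaleEtAl2020] arXiv:2005.03123 pp. 2–3 (abstract; §1 with Thm. 1.1 = Alman–Chen 2019 and the
  Goldreich–Tal statement) — held.
-/

noncomputable section

open Finset Filter

namespace Literature.Barriers.PneNP

/-! ### Rigidity and total nonsingularity -/

open Classical in
/-- The number of nonzero entries `|C|` of a matrix (counted with the classical decidability
instance for `≠ 0`, so that only `[Zero F]` is assumed). [cite: Lokam2009, Def. 2.1 (PDF p. 14)] -/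
def nnzEntries {n : ℕ} {F : Type*} [Zero F] (C : Matrix (Fin n) (Fin n) F) : ℕ :=
  (univ.filter fun p : Fin n × Fin n => C p.1 p.2 ≠ 0).card

/-- **Rigidity** `R^F_A(r) := min{|C| : rank_F(A + C) ≤ r}` — the least number of entries of `A`
that must be changed to bring the rank down to at most `r` (the minimum exists: `C = -A`
works). [cite: Lokam2009, Def. 2.1 (PDF p. 14)] -/
def rigidity {n : ℕ} {F : Type*} [Field F] (A : Matrix (Fin n) (Fin n) F) (r : ℕ) : ℕ :=
  sInf {s | ∃ C : Matrix (Fin n) (Fin n) F, (A + C).rank ≤ r ∧ nnzEntries C = s}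

/-- **Total nonsingularity**: all square submatrices of all sizes are nonsingular.
[cite: Lokam2009, Thm. 2.12 (PDF p. 25)] -/
def IsTotallyNonsingular {n : ℕ} {F : Type*} [Field F] (A : Matrix (Fin n) (Fin n) F) : Prop :=
  ∀ (m : ℕ) (ρ κ : Fin m ↪ Fin n), (A.submatrix ρ κ).det ≠ 0

/-- A matrix of rank `≤ r` has rigidity `0` at target rank `r` (take `C = 0`). [folklore] -/
theorem rigidity_of_rank_le {n : ℕ} {F : Type*} [Field F] {A : Matrix (Fin n) (Fin n) F} {r : ℕ}
    (h : A.rank ≤ r) : rigidity A r = 0 := by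
  apply Nat.eq_zero_of_le_zero
  apply Nat.sInf_le
  exact ⟨0, by simpa using h, by simp [nnzEntries]⟩

/-- Rigidity is at most `n²`: changing every entry (`C = -A`) gives the zero matrix.
[cite: Lokam2009, §2.1 (PDF p. 14: "`R^F_A(r) ≤ (n-r)²`", the weaker `n²` form)] -/
theorem rigidity_le_card {n : ℕ} {F : Type*} [Field F] (A : Matrix (Fin n) (Fin n) F) (r : ℕ) :
    rigidity A r ≤ n ^ 2 := by
  have hmem : nnzEntries (-A) ∈
      {s | ∃ C : Matrix (Fin n) (Fin n) F, (A + C).rank ≤ r ∧ nnzEntries C = s} :=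
    ⟨-A, by simp [Matrix.rank_zero], rfl⟩
  refine (Nat.sInf_le hmem).trans ?_
  unfold nnzEntries
  refine (card_le_univ _).trans ?_
  simp [Fintype.card_prod, Fintype.card_fin, sq]

/-! ### Limitation (i), proved: small hitting sets for `(r+1) × (r+1)` submatrices -/

/-- `C(N-k, m) · N^m ≤ C(N, m) · (N-k)^m`, i.e. `C(N-k,m)/C(N,m) ≤ (1 - k/N)^m`. [folklore] -/
theorem choose_sub_mul_pow_le (N k m : ℕ) :
    (N - k).choose m * N ^ m ≤ N.choose m * (N - k) ^ m := by
  suffices h : (N - k).descFactorial m * N ^ m ≤ N.descFactorial m * (N - k) ^ m by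
    rw [Nat.descFactorial_eq_factorial_mul_choose, Nat.descFactorial_eq_factorial_mul_choose,
      Nat.mul_assoc, Nat.mul_assoc] at h
    exact Nat.le_of_mul_le_mul_left h (Nat.factorial_pos m)
  induction m with
  | zero => simp
  | succ m ih =>
    have key : (N - k - m) * N ≤ (N - m) * (N - k) := by
      rcases le_or_gt (k + m) N with h | h
      · obtain ⟨c, rfl⟩ := Nat.exists_eq_add_of_le h
        have e1 : k + m + c - k - m = c := by omega
        have e2 : k + m + c - m = k + c := by omega
        have e3 : k + m + c - k = m + c := by omega
        rw [e1, e2, e3]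
        nlinarith
      · have e : N - k - m = 0 := by omega
        simp [e]
    calc (N - k).descFactorial (m + 1) * N ^ (m + 1)
        = ((N - k - m) * N) * ((N - k).descFactorial m * N ^ m) := by
          rw [Nat.descFactorial_succ, pow_succ]; ring
      _ ≤ ((N - m) * (N - k)) * (N.descFactorial m * (N - k) ^ m) := Nat.mul_le_mul key ih
      _ = N.descFactorial (m + 1) * (N - k) ^ (m + 1) := by
          rw [Nat.descFactorial_succ, pow_succ]; ring

/-- **Counting step.** If `C(n,k)² · C(n² - k², m) < C(n², m)` then some `m`-set of positions of
an `n × n` array meets every `k × k` combinatorial rectangle `R × C`. [folklore] -/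
theorem exists_hitting_of_choose_lt {n k m : ℕ}
    (h : (n.choose k) ^ 2 * (n ^ 2 - k ^ 2).choose m < (n ^ 2).choose m) :
    ∃ T : Finset (Fin n × Fin n), T.card = m ∧
      ∀ R C : Finset (Fin n), R.card = k → C.card = k → ∃ p ∈ T, p.1 ∈ R ∧ p.2 ∈ C := by
  classical
  by_contra hcon
  push Not at hcon
  set Ω := (univ : Finset (Fin n × Fin n)).powersetCard m with hΩ
  set Rect := ((univ : Finset (Fin n)).powersetCard k) ×ˢ ((univ : Finset (Fin n)).powersetCard k)
    with hRect
  have hΩcard : Ω.card = (n ^ 2).choose m := by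
    simp [Ω, card_powersetCard, Fintype.card_prod, Fintype.card_fin, sq]
  have hRectcard : Rect.card = (n.choose k) ^ 2 := by
    simp [Rect, card_product, card_powersetCard, Fintype.card_fin, sq]
  let miss : Finset (Fin n × Fin n) → Finset (Fin n) × Finset (Fin n) → Prop :=
    fun T RC => T ⊆ (RC.1 ×ˢ RC.2)ᶜ
  have h1 : ∀ T ∈ Ω, 1 ≤ (Rect.filter (fun RC => miss T RC)).card := by
    intro T hT
    rw [mem_powersetCard] at hT
    obtain ⟨R, C, hR, hC, hmiss⟩ := hcon T hT.2
    rw [Nat.one_le_iff_ne_zero, Ne, card_eq_zero, ← Ne, ← nonempty_iff_ne_empty]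
    refine ⟨(R, C), ?_⟩
    rw [mem_filter]
    refine ⟨by simp [Rect, mem_powersetCard, hR, hC], ?_⟩
    intro p hp
    rw [mem_compl, mem_product]
    exact fun hh => hmiss p hp hh.1 hh.2
  have h2 : ∀ RC ∈ Rect, (Ω.filter (fun T => miss T RC)).card = (n ^ 2 - k ^ 2).choose m := by
    rintro ⟨R, C⟩ hRC
    simp only [Rect, mem_product, mem_powersetCard] at hRC
    have hset : Ω.filter (fun T => miss T (R, C)) = ((R ×ˢ C)ᶜ).powersetCard m := by
      ext T
      simp only [Ω, mem_filter, mem_powersetCard, subset_univ, true_and, miss]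
      tauto
    rw [hset, card_powersetCard, card_compl, card_product, Fintype.card_prod, Fintype.card_fin,
      hRC.1.2, hRC.2.2, sq, sq]
  have hle : Ω.card ≤ Rect.card * (n ^ 2 - k ^ 2).choose m := by
    calc Ω.card = ∑ T ∈ Ω, 1 := by simp
      _ ≤ ∑ T ∈ Ω, (Rect.filter (fun RC => miss T RC)).card := sum_le_sum h1
      _ = ∑ T ∈ Ω, ∑ RC ∈ Rect, (if miss T RC then 1 else 0) := by simp_rw [card_filter]
      _ = ∑ RC ∈ Rect, ∑ T ∈ Ω, (if miss T RC then 1 else 0) := sum_comm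
      _ = ∑ RC ∈ Rect, (Ω.filter (fun T => miss T RC)).card := by simp_rw [card_filter]
      _ = ∑ RC ∈ Rect, (n ^ 2 - k ^ 2).choose m := sum_congr rfl h2
      _ = Rect.card * (n ^ 2 - k ^ 2).choose m := by simp
  rw [hΩcard, hRectcard] at hle
  omega

/-- **Analytic step.** If `m ≤ n²` and `2 n² ln C(n,k) < k² m` then
`C(n,k)² · C(n² - k², m) < C(n², m)`. [folklore] -/
theorem choose_sq_mul_choose_lt {n k m : ℕ} (hk : k ≤ n) (hn : 0 < n) (hmN : m ≤ n ^ 2)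
    (hm : 2 * (n : ℝ) ^ 2 * Real.log (n.choose k) < (k : ℝ) ^ 2 * m) :
    (n.choose k) ^ 2 * (n ^ 2 - k ^ 2).choose m < (n ^ 2).choose m := by
  set N := n ^ 2 with hN
  have hNR : (N : ℝ) = (n : ℝ) ^ 2 := by simp [hN]
  have hNpos : (0 : ℝ) < N := by rw [hNR]; positivity
  have hk2 : k ^ 2 ≤ N := Nat.pow_le_pow_left hk 2
  have hC : (0 : ℝ) < n.choose k := by exact_mod_cast Nat.choose_pos hk
  have hCN : (0 : ℝ) < N.choose m := by exact_mod_cast Nat.choose_pos hmN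
  have hD : ((N - k ^ 2).choose m : ℝ) * (N : ℝ) ^ m ≤
      (N.choose m : ℝ) * ((N : ℝ) - (k : ℝ) ^ 2) ^ m := by
    have := choose_sub_mul_pow_le N (k ^ 2) m
    have hcast : ((N - k ^ 2 : ℕ) : ℝ) = (N : ℝ) - (k : ℝ) ^ 2 := by
      push_cast [Nat.cast_sub hk2]; ring
    rw [← hcast]
    exact_mod_cast this
  have hq : 0 ≤ 1 - (k : ℝ) ^ 2 / N := by
    rw [sub_nonneg, div_le_one hNpos]
    exact_mod_cast hk2
  have hE : ((N - k ^ 2).choose m : ℝ) ≤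
      (N.choose m : ℝ) * Real.exp (-((k : ℝ) ^ 2 * m / N)) := by
    have h1 : ((N - k ^ 2).choose m : ℝ) ≤ (N.choose m : ℝ) * (1 - (k : ℝ) ^ 2 / N) ^ m := by
      have hNm : (0 : ℝ) < (N : ℝ) ^ m := by positivity
      have heq : (1 - (k : ℝ) ^ 2 / N) ^ m = ((N : ℝ) - (k : ℝ) ^ 2) ^ m / (N : ℝ) ^ m := by
        rw [← div_pow]
        congr 1
        field_simp
      rw [heq, mul_div_assoc', le_div_iff₀ hNm]
      exact hD
    have h2 : (1 - (k : ℝ) ^ 2 / N) ^ m ≤ Real.exp (-((k : ℝ) ^ 2 * m / N)) := by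
      calc (1 - (k : ℝ) ^ 2 / N) ^ m ≤ (Real.exp (-((k : ℝ) ^ 2 / N))) ^ m :=
            pow_le_pow_left₀ hq (Real.one_sub_le_exp_neg _) m
        _ = Real.exp (-((k : ℝ) ^ 2 * m / N)) := by
            rw [← Real.exp_nat_mul]
            congr 1
            ring
    exact h1.trans (mul_le_mul_of_nonneg_left h2 hCN.le)
  have hF : Real.exp (-((k : ℝ) ^ 2 * m / N)) < ((n.choose k : ℝ) ^ 2)⁻¹ := by
    have hpos : (0 : ℝ) < ((n.choose k : ℝ) ^ 2)⁻¹ := by positivity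
    rw [← Real.exp_log hpos, Real.exp_lt_exp, Real.log_inv, Real.log_pow, neg_lt_neg_iff,
      lt_div_iff₀ hNpos, hNR]
    push_cast
    linarith
  have key : ((n.choose k : ℝ)) ^ 2 * ((N - k ^ 2).choose m : ℝ) < (N.choose m : ℝ) := by
    calc (n.choose k : ℝ) ^ 2 * ((N - k ^ 2).choose m : ℝ)
        ≤ (n.choose k : ℝ) ^ 2 * ((N.choose m : ℝ) * Real.exp (-((k : ℝ) ^ 2 * m / N))) := by
          gcongr
      _ < (n.choose k : ℝ) ^ 2 * ((N.choose m : ℝ) * ((n.choose k : ℝ) ^ 2)⁻¹) := by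
          gcongr
      _ = N.choose m := by field_simp
  exact_mod_cast key

/-- **Clause (i) of the barrier — the untouched-submatrix step is capped** (named statement,
PROVED below as `untouched_submatrix_cover`): for all `1 ≤ r ≤ n/2` some set of at most
`6 (n²/r) ln(n/r)` positions of the `n × n` array meets every `(r+1) × (r+1)` submatrix.
Lokam: "consider the hypergraph whose vertices are the entries of an `n × n` matrix and
hyperedges are all `(r+1) × (r+1)` submatrices ... `O((n²/r) log(n/(r+1)))` changes suffice" to
meet every hyperedge [cite: Lokam2009, §2.2.1 (PDF p. 24)]; here with the explicit constant `6`
and natural logarithm (stronger than the printed `O(·)`, which is recovered in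
`untouched_submatrix_cover_bigO`), for `1 ≤ r ≤ n/2` ("we assume `r ≤ n/2`", PDF p. 20). -/
def UntouchedSubmatrixCap : Prop :=
  ∀ (n r : ℕ), 2 * r ≤ n → 0 < r →
    ∃ T : Finset (Fin n × Fin n),
      (T.card : ℝ) ≤ 6 * ((n : ℝ) ^ 2 / r) * Real.log ((n : ℝ) / r) ∧
      ∀ (R C : Finset (Fin n)), R.card = r + 1 → C.card = r + 1 →
        ∃ p ∈ T, p.1 ∈ R ∧ p.2 ∈ C

/-- **Limitation (i), proved**: the untouched-submatrix step is capped at `6 (n²/r) ln(n/r)`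
for all `1 ≤ r ≤ n/2` (by the union-bound count rather than Lovász's fractional cover).
[cite: Lokam2009, §2.2.1 (PDF p. 24)] -/
theorem untouched_submatrix_cover : UntouchedSubmatrixCap := by
  intro n r hrn hr
  have hn2 : 2 ≤ n := by omega
  have hkn : r + 1 ≤ n := by omega
  have hrR : (0 : ℝ) < r := by exact_mod_cast hr
  have hnR : (2 : ℝ) * r ≤ n := by exact_mod_cast hrn
  have hnpos : (0 : ℝ) < n := by linarith
  have hkR : (0 : ℝ) < ((r + 1 : ℕ) : ℝ) := by positivity
  set L := Real.log ((n : ℝ) / r) with hL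
  have hL2 : Real.log 2 ≤ L := by
    apply Real.log_le_log (by norm_num)
    rw [le_div_iff₀ hrR]
    linarith
  have hL0 : (2 : ℝ) / 3 ≤ L := le_trans (by have := Real.log_two_gt_d9; linarith) hL2
  have hC : (0 : ℝ) < n.choose (r + 1) := by exact_mod_cast Nat.choose_pos hkn
  have hC1 : (1 : ℝ) ≤ n.choose (r + 1) := by exact_mod_cast Nat.choose_pos hkn
  set x : ℝ := 2 * (n : ℝ) ^ 2 * Real.log (n.choose (r + 1)) / ((r + 1 : ℕ) : ℝ) ^ 2 with hx
  have hx0 : 0 ≤ x := by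
    have := Real.log_nonneg hC1
    positivity
  set m : ℕ := ⌊x⌋₊ + 1 with hm
  have hxm : x < m := by
    simp only [hm]
    push_cast
    exact Nat.lt_floor_add_one x
  have hmx : (m : ℝ) ≤ x + 1 := by
    simp only [hm]
    push_cast
    linarith [Nat.floor_le hx0]
  -- ln C(n,k) ≤ k (1 + ln(n/k))
  have hlogC : Real.log (n.choose (r + 1)) ≤
      ((r + 1 : ℕ) : ℝ) * (1 + Real.log ((n : ℝ) / ((r + 1 : ℕ) : ℝ))) := by
    set k := r + 1 with hk
    have h1 : (n.choose k : ℝ) ≤ (n : ℝ) ^ k / (k.factorial : ℝ) := by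
      have := Nat.choose_le_pow_div (α := ℝ) k n
      exact_mod_cast this
    have h2 : (k : ℝ) ^ k / (k.factorial : ℝ) ≤ Real.exp k :=
      Real.pow_div_factorial_le_exp (hx := hkR.le) (n := k)
    have hkk : (0 : ℝ) < (k : ℝ) ^ k := by positivity
    have hfac : (0 : ℝ) < (k.factorial : ℝ) := by exact_mod_cast Nat.factorial_pos k
    have h3 : (n.choose k : ℝ) ≤ (Real.exp 1 * n / k) ^ k := by
      calc (n.choose k : ℝ) ≤ (n : ℝ) ^ k / (k.factorial : ℝ) := h1
        _ = ((n : ℝ) / k) ^ k * ((k : ℝ) ^ k / (k.factorial : ℝ)) := by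
            rw [div_pow]
            field_simp
        _ ≤ ((n : ℝ) / k) ^ k * Real.exp k := by gcongr
        _ = (Real.exp 1 * n / k) ^ k := by
            rw [← Real.exp_one_pow, mul_div_assoc, mul_pow, mul_comm]
    calc Real.log (n.choose k) ≤ Real.log ((Real.exp 1 * n / k) ^ k) := Real.log_le_log hC h3
      _ = k * Real.log (Real.exp 1 * ((n : ℝ) / k)) := by rw [Real.log_pow, mul_div_assoc]
      _ = k * (1 + Real.log ((n : ℝ) / k)) := by
          rw [Real.log_mul (Real.exp_pos 1).ne' (by positivity), Real.log_exp]
  -- hence x ≤ 2 (n²/r) (1 + L)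
  have hx_le : x ≤ 2 * ((n : ℝ) ^ 2 / r) * (1 + L) := by
    have hk_gt : (r : ℝ) < ((r + 1 : ℕ) : ℝ) := by push_cast; linarith
    have hlogk : Real.log ((n : ℝ) / ((r + 1 : ℕ) : ℝ)) ≤ L := by
      apply Real.log_le_log (by positivity)
      exact div_le_div_of_nonneg_left hnpos.le hrR hk_gt.le
    have h1L : 0 ≤ 1 + Real.log ((n : ℝ) / ((r + 1 : ℕ) : ℝ)) := by
      have h1 : (1 : ℝ) ≤ (n : ℝ) / ((r + 1 : ℕ) : ℝ) := by
        rw [le_div_iff₀ hkR, one_mul]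
        exact_mod_cast hkn
      have := Real.log_nonneg h1
      linarith
    calc x = 2 * (n : ℝ) ^ 2 * Real.log (n.choose (r + 1)) / ((r + 1 : ℕ) : ℝ) ^ 2 := rfl
      _ ≤ 2 * (n : ℝ) ^ 2 * (((r + 1 : ℕ) : ℝ) * (1 + Real.log ((n : ℝ) / ((r + 1 : ℕ) : ℝ))))
            / ((r + 1 : ℕ) : ℝ) ^ 2 := by
          gcongr
      _ = 2 * (n : ℝ) ^ 2 * (1 + Real.log ((n : ℝ) / ((r + 1 : ℕ) : ℝ))) / ((r + 1 : ℕ) : ℝ) := by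
          field_simp
      _ ≤ 2 * (n : ℝ) ^ 2 * (1 + L) / ((r + 1 : ℕ) : ℝ) := by gcongr
      _ ≤ 2 * (n : ℝ) ^ 2 * (1 + L) / r := by
          apply div_le_div_of_nonneg_left _ hrR hk_gt.le
          have : 0 ≤ 1 + L := by linarith
          positivity
      _ = 2 * ((n : ℝ) ^ 2 / r) * (1 + L) := by ring
  -- and so m ≤ 6 (n²/r) L
  have hm_le : (m : ℝ) ≤ 6 * ((n : ℝ) ^ 2 / r) * L := by
    have hA : (4 : ℝ) ≤ (n : ℝ) ^ 2 / r := by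
      rw [le_div_iff₀ hrR]
      have : (2 : ℝ) ≤ n := by exact_mod_cast hn2
      nlinarith
    have hpos : (0 : ℝ) ≤ (n : ℝ) ^ 2 / r := by positivity
    have h1 : (1 : ℝ) ≤ ((n : ℝ) ^ 2 / r) * L := by nlinarith
    nlinarith [hmx, hx_le]
  rcases le_or_gt m (n ^ 2) with hmN | hmN
  · have hlt : (n.choose (r + 1)) ^ 2 * (n ^ 2 - (r + 1) ^ 2).choose m < (n ^ 2).choose m := by
      apply choose_sq_mul_choose_lt hkn (by omega) hmN
      have h1 : x * ((r + 1 : ℕ) : ℝ) ^ 2 < (m : ℝ) * ((r + 1 : ℕ) : ℝ) ^ 2 :=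
        mul_lt_mul_of_pos_right hxm (by positivity)
      have hx' : x * ((r + 1 : ℕ) : ℝ) ^ 2 = 2 * (n : ℝ) ^ 2 * Real.log (n.choose (r + 1)) := by
        simp only [hx]
        field_simp
      rw [hx'] at h1
      push_cast at h1 ⊢
      linarith
    obtain ⟨T, hTcard, hT⟩ := exists_hitting_of_choose_lt hlt
    exact ⟨T, by rw [hTcard]; exact hm_le, hT⟩
  · refine ⟨univ, ?_, ?_⟩
    · calc (((univ : Finset (Fin n × Fin n)).card : ℕ) : ℝ) = ((n ^ 2 : ℕ) : ℝ) := by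
            simp [Finset.card_univ, Fintype.card_prod, Fintype.card_fin, sq]
        _ ≤ m := by exact_mod_cast hmN.le
        _ ≤ 6 * ((n : ℝ) ^ 2 / r) * L := hm_le
    · intro R C hR hC
      obtain ⟨i, hi⟩ : R.Nonempty := by rw [← card_pos]; omega
      obtain ⟨j, hj⟩ : C.Nonempty := by rw [← card_pos]; omega
      exact ⟨(i, j), mem_univ _, hi, hj⟩

/-- The printed `O(·)` form of limitation (i): for an absolute constant `c > 0` and all
`1 ≤ r ≤ n/2`, some `≤ c (n²/r) log(n/r)` positions meet every `(r+1) × (r+1)` submatrix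
(from `untouched_submatrix_cover`, `c = 6`). [cite: Lokam2009, §2.2.1 (PDF p. 24)] -/
theorem untouched_submatrix_cover_bigO :
    ∃ c : ℝ, 0 < c ∧ ∀ (n r : ℕ), 2 * r ≤ n → 0 < r →
      ∃ T : Finset (Fin n × Fin n),
        (T.card : ℝ) ≤ c * ((n : ℝ) ^ 2 / r) * Real.log ((n : ℝ) / r) ∧
        ∀ (R C : Finset (Fin n)), R.card = r + 1 → C.card = r + 1 →
          ∃ p ∈ T, p.1 ∈ R ∧ p.2 ∈ C :=
  ⟨6, by norm_num, untouched_submatrix_cover⟩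

/-! ### The barrier fact -/

/-- **Limitation (ii): total nonsingularity alone is capped at `n^{1+o(1)}`** (Thm. 2.12,
Valiant): "There exist `n × n` matrices `A` with integer entries such that all submatrices of
`A` of all sizes are nonsingular, and yet `R_A(r) = n^{1+o(1)}` for `r = εn` for any `ε > 0`."
As printed and proved (PDF pp. 25–26) this is ONE family `A_n` (built from one linear-size
logarithmic-depth superconcentrator, before `ε` is chosen), totally nonsingular, such that for
every `ε > 0` the decomposition of Thm. 2.1 gives `R_{A_n}(εn) ≤ n · 2^{log^{1-δ} n} = n^{1+o(1)}`.
Rendered: one family `A : (n : ℕ) → Matrix (Fin n) (Fin n) ℤ`, every `A n` totally nonsingular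
over `ℚ`, and for every `ε > 0` and every `η > 0`, eventually
`R_{A_n}(⌈εn⌉) ≤ n^{1+η}` (the `n^{1+η}`-eventually reading of the upper bound `n^{1+o(1)}`;
only this UPPER half of "`R_A(r) = n^{1+o(1)}`" is vendored; `ℚ`-rigidity of the integer
matrix, the printed change matrix `C` being integral). Named fact (users take
`(h : Lokam2009_thm_2_12)`), PROVED in the sibling file `RigidityCombinatorialBarrierProofs.lean`
(`Lokam2009_thm_2_12_holds`): not by the printed route — the superconcentrator construction and
Thm. 2.1's decomposition are not in the tree — but by taking the witness of
`totalNonsingularity_cap` at the vanishing rank `⌊n/⌊log₂ n⌋⌋` (rigidity `≤ 24 n ln² n` there,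
`n ≥ 4`) and antitonicity of rigidity in the target rank.
[cite: Lokam2009, Thm. 2.12 (PDF p. 25)] -/
def Lokam2009_thm_2_12 : Prop :=
  ∃ A : (n : ℕ) → Matrix (Fin n) (Fin n) ℤ,
    (∀ n, IsTotallyNonsingular ((A n).map (Int.cast : ℤ → ℚ))) ∧
    ∀ ε : ℝ, 0 < ε → ∀ η : ℝ, 0 < η → ∀ᶠ n : ℕ in atTop,
      (rigidity ((A n).map (Int.cast : ℤ → ℚ)) ⌈ε * n⌉₊ : ℝ) ≤ (n : ℝ) ^ (1 + η)

/-- The pointwise consequence of Thm. 2.12 (matrices allowed to depend on `ε, η`): for every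
`ε, η > 0` and all large `n` there is a totally nonsingular integer `n × n` matrix with
`R(⌈εn⌉) ≤ n^{1+η}`. [cite: Lokam2009, Thm. 2.12 (PDF p. 25)] -/
theorem Lokam2009_thm_2_12.forall_eventually_exists (h : Lokam2009_thm_2_12) :
    ∀ ε : ℝ, 0 < ε → ∀ η : ℝ, 0 < η → ∀ᶠ n : ℕ in atTop,
      ∃ A : Matrix (Fin n) (Fin n) ℤ,
        IsTotallyNonsingular (A.map (Int.cast : ℤ → ℚ)) ∧
        (rigidity (A.map (Int.cast : ℤ → ℚ)) ⌈ε * n⌉₊ : ℝ) ≤ (n : ℝ) ^ (1 + η) := by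
  obtain ⟨A, hA, hR⟩ := h
  intro ε hε η hη
  filter_upwards [hR ε hε η hη] with n hn
  exact ⟨A n, hA n, hn⟩

/-- **The barrier of purely combinatorial approaches to rigidity** (Lokam §2.2.1, Thm. 2.12):
the conjunction of the two printed limitations. (i) *The untouched-submatrix step is capped at
`O((n²/r) log(n/r))`*: "Any proof relying on ... an untouched submatrix of rank `Ω(r)` is
incapable of producing a lower bound better than `Ω((n²/r) log(n/r))` ...
`(n²/(r+1)²)(1 + ln C(n-1,r)²) = O((n²/r) log(n/(r+1)))` changes suffice" — clause
`UntouchedSubmatrixCap` (with the explicit constant `6`; PROVED, `untouched_submatrix_cover`).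
(ii) *Total nonsingularity alone is capped at `n^{1+o(1)}`* (Thm. 2.12, one family for all
`ε`) = `Lokam2009_thm_2_12` (named fact, PROVED in the sibling file
`RigidityCombinatorialBarrierProofs.lean`: `Lokam2009_thm_2_12_holds`). By
`rigidityCombinatorialBarrier_iff` the barrier is equivalent to (ii); it is PROVED there as
`RigidityCombinatorialBarrier_holds`.

BARRIER
technique_class: matrix-rigidity, rigidity, valiant-rigidity, linear-circuits, linear-circuit-lower-bounds, untouched-submatrix-arguments, total-nonsingularity, combinatorial-rigidity-lower-bounds, superconcentrator-connectivity
blocks: Valiant's rigidity road (not itself a filed crux; cf. route PneNP/Circuit crux #2, superlinear size) to superlinear size lower bounds for logarithmic-depth linear circuits computing an explicit linear map ("if `R_A(εn) ≥ n^{1+δ}` ... any linear circuit of logarithmic depth computing `x ↦ Ax` must have size `Ω(n log log n)`", Thm. 2.1; Open Question 2.1) insofar as the rigidity bound is proved by the two-step strategy that "proofs of the best known lower bounds on rigidity of explicit matrices follow" — (1) square submatrices have full rank, (2) few changes leave one untouched: step (2) cannot certify more than `O((n²/r) log(n/r))` changes because that many positions already meet every `(r+1) × (r+1)` submatrix (clause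 (i)), and step (1) cannot be strengthened into rigidity because one totally nonsingular family has rigidity `n^{1+o(1)}` at rank `εn` for every `ε` (clause (ii), Thm. 2.12); at `r = εn` the cap `O((n/ε) log(1/ε)) = O(n)` is far below `n^{1+δ}` [cite: Lokam2009, Thm. 2.1 (PDF p. 17), Open Question 2.1 (PDF p. 15), §2.2.1 and Thm. 2.12 (PDF pp. 24–26)]; the same connectivity-only limitation caps depth-2 factorization bounds `w₂(A)` at the tight depth-2 superconcentrator bound `Ω(n log² n / log log n)` [cite: Lokam2009, §2.3 (PDF pp. 26–27)].
because: (i) the `(r+1) × (r+1)` submatrices form a regular hypergraph on the `n²` positions of degree `d = C(n-1, r)²` with fractional cover number `t* = n²/(r+1)²`, and Lovász's greedy bound `t ≤ t*(ln d + 1)` yields an integral cover of size `O((n²/r) log(n/r))` [cite: Lokam2009, §2.2.1 (PDF p. 24)]; (ii) a superconcentrator with `O(n)` edges and depth `O(log n)` (Pippenger) is turned into an integer linear circuit whose coefficients are chosen inductively to keep every sub-determinant nonzero (vertex-disjoint paths ⇒ nonsingular minors), and Valiant's edge-removal decomposition of that linear-size circuit writes, for every `ε > 0`, `A = B + C` with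 `rank B ≤ εn`, `|C| ≤ n · 2^{log^{1-δ} n}` [cite: Lokam2009, proof of Thm. 2.12 (PDF pp. 25–26) and proof of Thm. 2.1 (PDF pp. 17–18)].
evasions_known: arguments using the ALGEBRAIC structure of the entries: Shoup–Smolensky dimension / algebraic independence give the quadratic `R_P(r) ≥ n(n - 16r)` (in particular `R_P(n/17) ≥ n²/17`) for the matrix of square roots of distinct primes and for generic matrices — strong rigidity, but for matrices not explicit in the sense of Open Question 2.1 [cite: Lokam2009, §2.4, Thms. 2.18–2.21, Cor. 2.19 (PDF pp. 27, 33–35)]; on the candidate side, several classical conjecturally-rigid families are now known NOT to be Valiant-rigid — Walsh–Hadamard (`R_{H_n}(2^{n-f(ε)n}) ≤ 2^{n(1+ε)}` over every field) [cite: AlmanWilliams2017, Thm. 1.1 (arXiv p. 4)], and circulant / Toeplitz / DFT matrices [cite: DvirLiu2019, abstract (arXiv p. 2)] — so a successful proof must also pick its explicit family outside these; OUTSIDE the technique class (neither untouched-submatrix nor rank-profile arguments) and exceeding the step-(2) quantity `(n²/r) log(n/r)` in their own regimes, though neither `P`-explicit nor at rank `εn`: PCP-based constructions — an `FNP`-machine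 outputs, for infinitely many `N`, `N × N` matrices over `𝔽₂` that are `δN²`-far from every matrix of rank `≤ 2^{log N/Ω(log log N)}` [cite: BhangaleEtAl2020, abstract (arXiv p. 2)], strengthening the Alman–Chen (FOCS 2019) `FNP` construction of `(δN², 2^{(log N)^{1/4-ε}})`-rigid matrices [cite: BhangaleEtAl2020, Thm. 1.1 (arXiv p. 3)] (at such ranks `ρ = N^{o(1)}` one has `(N²/ρ) log(N/ρ) = o(N²)`); and hashing-based semi-explicit ones — Goldreich–Tal's random Toeplitz matrices (`O(N)` random bits) are `(N³/(ρ² log N), ρ)`-rigid for every `ρ ≥ √N` w.h.p. [cite: BhangaleEtAl2020, §1 (arXiv p. 3)], which is `ω((N²/ρ) log(N/ρ))` throughout `√N ≤ ρ ≤ N/log² N`.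
scope_caveats: clause (i) is the existence of a small hitting set for `(r+1) × (r+1)` submatrices (what Lokam's computation proves; proved here for all `1 ≤ r ≤ n/2` with constant `6` and natural log); it bounds arguments whose ONLY certificate is an untouched `(r+1) × (r+1)` submatrix ("of rank `Ω(r)`") and says nothing about the true rigidity of any particular matrix; clause (ii) as printed (`n^{1+o(1)}` at `εn`) is far from sharp — `TotalNonsingularityCap` (end of file; PROVED in `RigidityCombinatorialBarrierProofs.lean`, `totalNonsingularity_cap`) gives for every `1 ≤ r ≤ n/2` a totally nonsingular integer matrix with `R^ℚ_A(r) ≤ 6 (n²/r) ln(n/r)` (`O(n)` at `εn`), and `exists_hitting_iff_exists_totallyNonsingular` there shows that the least `R^ℚ_A(r)` over totally nonsingular matrices EQUALS the least hitting set for `(r+1) × (r+1)` submatrices: hence every argument whose only input about `A` is a property implied by total nonsingularity (any profile of ranks of submatrices — touched or untouched, one submatrix or many, rank `Ω(r)` or `o(r)`) is capped at the step-(2) quantity, and what remains uncovered is any use of the explicit matrix beyond its submatrix-rank profile (the entries' algebra as in §2.4, or complexity-theoretic structure as in the `FNP` constructions of `evasions_known:`); the `technique_class:` tags `matrix-rigidity,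 rigidity, valiant-rigidity, linear-circuits, linear-circuit-lower-bounds` are topic tags — the results bind only two-step / rank-profile arguments, not rigidity lower bounds as such; clause (ii) is existential and non-explicit (one family from a superconcentrator, not claimed explicit), rendered with target rank `⌈εn⌉` and bound `n^{1+η}` for every `η > 0` eventually (the reading of the printed upper bound `n^{1+o(1)}`; the matching lower half of "`R_A(r) = n^{1+o(1)}`" is not vendored), over `ℚ`; Lokam's phrase "barrier of purely combinatorial approaches" (§2.4, PDF p. 27) names the limitations of "the last two subsections", i.e. ALSO the §2.3 depth-2 factorization / depth-2-superconcentrator limitation on `w₂(A)` (Lemma 2.15–Thm. 2.16, PDF pp. 26–27), which this file only quotes (in `blocks:`) and does not vendor; Valiant's Thm. 2.1 and linear circuits are quoted, not formalised (no linear-circuit model in the tree); the "barrier" is Lokam's name for these printed limitations, not a theorem about all combinatorial arguments.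
status: established [cite: Lokam2009, §2.2.1 and Thm. 2.12] — proved in this tree (`Literature/Barriers/PneNP/RigidityCombinatorialBarrierProofs.lean`, `RigidityCombinatorialBarrier_holds`) -/
def RigidityCombinatorialBarrier : Prop :=
  UntouchedSubmatrixCap ∧ Lokam2009_thm_2_12

/-- Given the proof of limitation (i), the barrier is exactly Thm. 2.12.
[cite: Lokam2009, §2.2.1 and Thm. 2.12 (PDF pp. 24–25)] -/
theorem rigidityCombinatorialBarrier_iff : RigidityCombinatorialBarrier ↔ Lokam2009_thm_2_12 :=
  ⟨fun h => h.2, fun h => ⟨untouched_submatrix_cover, h⟩⟩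

/-! ### Readings -/

/-- **What an untouched-submatrix argument can certify** (unconditional). If, for a number `R₀`,
one knows only that "fewer than `R₀` changed positions always leave some `(r+1) × (r+1)`
submatrix untouched" (the second step of the standard strategy), then
`R₀ ≤ 6 (n²/r) ln(n/r)` whenever `1 ≤ r ≤ n/2` — whatever the matrix is.
[cite: Lokam2009, §2.2.1 (PDF p. 24)] -/
theorem no_untouched_submatrix_bound (n r : ℕ) (h2 : 2 * r ≤ n) (h3 : 0 < r) (R₀ : ℕ)
    (harg : ∀ T : Finset (Fin n × Fin n), T.card < R₀ →
      ∃ (R C : Finset (Fin n)), R.card = r + 1 ∧ C.card = r + 1 ∧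
        ∀ p ∈ T, ¬ (p.1 ∈ R ∧ p.2 ∈ C)) :
    (R₀ : ℝ) ≤ 6 * ((n : ℝ) ^ 2 / r) * Real.log ((n : ℝ) / r) := by
  obtain ⟨T, hT, hhit⟩ := untouched_submatrix_cover n r h2 h3
  by_contra hlt
  push Not at hlt
  have hTR : T.card < R₀ := by exact_mod_cast hT.trans_lt hlt
  obtain ⟨R, C, hR, hC, hmiss⟩ := harg T hTR
  obtain ⟨p, hp, hp1, hp2⟩ := hhit R C hR hC
  exact hmiss p hp ⟨hp1, hp2⟩

/-- **Total nonsingularity does not imply Valiant-rigidity**: there is ONE family of totally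
nonsingular integer matrices `A_n` such that for every `ε, δ > 0`, for all large `n`,
`R_{A_n}(⌈εn⌉) ≤ n^{1+δ/2} < n^{1+δ}` — so `{A_n}` fails the hypothesis `R_A(εn) ≥ n^{1+δ}` of
Valiant's criterion for every choice of `ε, δ`. [cite: Lokam2009, Thm. 2.12 (PDF p. 25)] -/
theorem Lokam2009_thm_2_12.exists_totallyNonsingular_not_rigid (h : Lokam2009_thm_2_12) :
    ∃ A : (n : ℕ) → Matrix (Fin n) (Fin n) ℤ,
      (∀ n, IsTotallyNonsingular ((A n).map (Int.cast : ℤ → ℚ))) ∧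
      ∀ ε : ℝ, 0 < ε → ∀ δ : ℝ, 0 < δ → ∀ᶠ n : ℕ in atTop,
        (rigidity ((A n).map (Int.cast : ℤ → ℚ)) ⌈ε * n⌉₊ : ℝ) < (n : ℝ) ^ (1 + δ) := by
  obtain ⟨A, hA, hR⟩ := h
  refine ⟨A, hA, fun ε hε δ hδ => ?_⟩
  filter_upwards [hR ε hε (δ / 2) (by positivity), eventually_gt_atTop 1] with n hn hn1
  refine hn.trans_lt ?_
  have hn' : (1 : ℝ) < n := by exact_mod_cast hn1
  exact Real.rpow_lt_rpow_of_exponent_lt hn' (by linarith)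

/-- The same reading from the barrier. [cite: Lokam2009, Thm. 2.12 (PDF p. 25)] -/
theorem RigidityCombinatorialBarrier.exists_totallyNonsingular_not_rigid
    (h : RigidityCombinatorialBarrier) :
    ∃ A : (n : ℕ) → Matrix (Fin n) (Fin n) ℤ,
      (∀ n, IsTotallyNonsingular ((A n).map (Int.cast : ℤ → ℚ))) ∧
      ∀ ε : ℝ, 0 < ε → ∀ δ : ℝ, 0 < δ → ∀ᶠ n : ℕ in atTop,
        (rigidity ((A n).map (Int.cast : ℤ → ℚ)) ⌈ε * n⌉₊ : ℝ) < (n : ℝ) ^ (1 + δ) :=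
  h.2.exists_totallyNonsingular_not_rigid

/-! ### Limitation (ii), sharp form (barrier audit 2026-08-14) -/

/-- **Limitation (ii), sharp form: total nonsingularity is capped at the step-(2) quantity
itself.** For all `1 ≤ r ≤ n/2` there is a totally nonsingular integer `n × n` matrix `A` with
`R^ℚ_A(r) ≤ 6 (n²/r) ln(n/r)` — the same quantity that caps the untouched-submatrix step
(`UntouchedSubmatrixCap`), against the printed "`R_A(r) = n^{1+o(1)}` for `r = εn`" of
Thm. 2.12 (`Lokam2009_thm_2_12`); at `r = εn` it is `O((n/ε) log(1/ε)) = O(n)`. PROVED in the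
sibling file `Literature/Barriers/PneNP/RigidityCombinatorialBarrierProofs.lean`
(`totalNonsingularity_cap`, whose type is literally this statement), together with: for ANY set
`T` meeting every `(r+1) × (r+1)` submatrix some totally nonsingular integer `A` has
`R^ℚ_A(r) ≤ |T|` (`exists_totallyNonsingular_rigidity_le_card`); the converse
untouched-submatrix bound for totally nonsingular matrices (`IsTotallyNonsingular.le_rigidity`,
the proof of Thm. 2.5); hence EXACT tightness — a hitting set of size `≤ m` exists iff a
totally nonsingular matrix of rigidity `≤ m` does (`exists_hitting_iff_exists_totallyNonsingular`);
`O(n)` at rank `⌈εn⌉` (`exists_totallyNonsingular_rigidity_linear`); and the pointwise reading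
`∀ ε η > 0, ∀ᶠ n, ∃ A` totally nonsingular with `R(⌈εn⌉) ≤ n^{1+η}` of Thm. 2.12 WITHOUT the
named fact (`forall_eventually_exists_totallyNonsingular`), and the one-family-for-all-`ε` form
`Lokam2009_thm_2_12` itself (`Lokam2009_thm_2_12_holds`: the witnesses of
`totalNonsingularity_cap` at the vanishing rank `⌊n/⌊log₂ n⌋⌋`, then antitonicity in the rank).

BARRIER
technique_class: total-nonsingularity, submatrix-rank-profile, untouched-submatrix-arguments, combinatorial-rigidity-lower-bounds, matrix-rigidity
blocks: every rigidity lower-bound argument whose only input about the explicit matrix `A` is a property implied by total nonsingularity — in particular any profile of ranks of submatrices (all square submatrices nonsingular; every `a × b` submatrix of rank `min(a,b)`; touched or untouched, one or many) — from certifying more than the least hitting set for the `(r+1) × (r+1)` submatrices, which is `≤ 6 (n²/r) ln(n/r)` for `1 ≤ r ≤ n/2` (clause (i), `untouched_submatrix_cover`), i.e. `O(n)` at `r = εn` against the `R_A(εn) ≥ n^{1+δ}` that Valiant's criterion needs [cite: Lokam2009, Thm. 2.1 and Open Question 2.1 (PDF pp. 15–17), §2.2.1 and Thm. 2.12 (PDF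 pp. 24–25)]: such an argument proves the same bound for the totally nonsingular witness `A_T`, whose rigidity is at most `|T|`.
because: given `T` meeting every `(r+1) × (r+1)` submatrix, greedily extracting entries of `T` shows that every `k × k` submatrix with `k > r` contains `k - r` positions of `T` no two in a row or column; completing them by `≤ r` coordinate vectors through `U Vᵀ` realises a permutation pattern, so by Laplace expansion along a `T`-entry and induction on `k` every `k × k` minor of the generic `U Vᵀ + C_T` (`U, V` of size `n × r`, `C_T` supported in `T`) is a nonzero integer polynomial; the product of the finitely many minors is nonzero over the infinite domain `ℤ`, so ONE integer point makes all minors nonzero at once, while `A - C_T = U Vᵀ` has rank `≤ r` and `|C_T| ≤ |T|`; conversely, if fewer than `τ` changes always leave an `(r+1) × (r+1)` submatrix untouched, that submatrix of `A + C` is a nonsingular submatrix of `A` and `rank (A + C) ≥ r + 1` [cite: Lokam2009, Lemma 2.4 and proof of Thm. 2.5 (PDF pp. 19–20)].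
evasions_known: as for `RigidityCombinatorialBarrier` — use of the entries' algebra (Shoup–Smolensky dimension: `R_P(r) ≥ n(n - 16r)` for square roots of distinct primes or algebraically independent entries, not explicit in the sense of Open Question 2.1) [cite: Lokam2009, §2.4, Thms. 2.18–2.21 (PDF pp. 27, 33–35)]; complexity-theoretic `FNP` constructions `δN²`-far from rank `2^{log N/Ω(log log N)}` via rectangular PCPs [cite: BhangaleEtAl2020, abstract (arXiv p. 2)] — none a `P`-explicit family at rank `εn`.
scope_caveats: existential and over `ℚ` (integer matrices, `ℚ`-rank, as in `Lokam2009_thm_2_12`); one witness per pair `(n, r)`, unlike Thm. 2.12's single family serving every `ε` at once; it says nothing about the rigidity of any particular explicit matrix (Cauchy, Fourier of prime order, good codes, Vandermonde), only that total nonsingularity ALONE certifies no more than the step-(2) quantity; finite fields are not treated (the generic-point step uses that `ℤ` is infinite); the constant `6` and the natural logarithm are inherited from `untouched_submatrix_cover`, and the range is `1 ≤ r ≤ n/2`.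
status: established — proved in this tree (`Literature/Barriers/PneNP/RigidityCombinatorialBarrierProofs.lean`, `totalNonsingularity_cap`); the printed weaker form is [cite: Lokam2009, Thm. 2.12 (PDF p. 25)] -/
def TotalNonsingularityCap : Prop :=
  ∀ (n r : ℕ), 2 * r ≤ n → 0 < r →
    ∃ A : Matrix (Fin n) (Fin n) ℤ, IsTotallyNonsingular (A.map (Int.cast : ℤ → ℚ)) ∧
      (rigidity (A.map (Int.cast : ℤ → ℚ)) r : ℝ) ≤ 6 * ((n : ℝ) ^ 2 / r) * Real.log ((n : ℝ) / r)

end Literature.Barriers.PneNP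

end

namespace Literature.Barriers.PneNP

/-- **`UntouchedSubmatrixCap` is a theorem of the tree (audit alias).** The named fact
`UntouchedSubmatrixCap` (`RigidityCombinatorialBarrier.lean`): Clause (i) of the barrier — the
untouched-submatrix step is capped (named statement, PROVED below as
`untouched_submatrix_cover`): … — is proved outright by `untouched_submatrix_cover` (this
file); this alias records the discharge under the census/audit name
`UntouchedSubmatrixCap_holds` (librarian sweep g25, pass 5c; no new mathematics).
[cite: Lokam2009, §2.2.1 (PDF p. 24)] -/
theorem UntouchedSubmatrixCap_holds :
    UntouchedSubmatrixCap :=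
  untouched_submatrix_cover

end Literature.Barriers.PneNP
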